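import Summits.ValiantsHypothesis.ValiantsHypothesis.Theorems.PolyaContinuedPfaffianNormalForm
import Literature.Barriers.ValiantsHypothesis.MonotoneGapPermanentLower
import Literature.Computability.AlgebraicComplexity.PermanentVsDeterminantProofs

/-!
# PolyaContinued / CoverDecancellation — the two SUPPORTS of line `laplace_rigidity`, part A (Stage 1: homogeneity,
# layering, the homogeneous cut)

PORT (val-lit-p4 g11, 2026-08-28, desk RULINGS #169/#182, R46) of val-idea-10 g0's sorry-free crux workfile
`Cruxes/CoverDecancellation/Lines/laplace_rigidity_supports.lean` (tree copy of 03:45Z, sha12 8878d7912e31) into `Theorems/`,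
token-for-token, namespace `…Theorems.PolyaContinuedLaplaceRigidity.Supports` (OUT of the Cruxes file's
`…Theorems.PolyaContinued.LaplaceRigidity` to avoid a name clash with the workfile), split in two by the 400-line rule:
part A (this file) = Stage 1 (homogeneity / layering bookkeeping and `homogeneous_cut`), part B
(`Theorems/PolyaContinuedLaplaceRigiditySupportsB.lean`) = Stage 2 `coverCut` + Stage 3 `zeroOneGrenet`.  Proofs unchanged.
Helper mode (`--supports stmt-ValiantsHypothesis-17819 --as helper`).

FROM THE SOURCE.  `coverCut` — cutting a cover: a complex Pfaffian cover of `per_n` of size `m` yields a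
`(⌊n/2⌋, ⌈n/2⌉)` two-factor decomposition `per_n = Σ_{i<w} p_i q_i` of width `w ≤ 2 (2m³ + 2) ≤ 2^{6(log₂ m + 1)}`: cover ⇒
affine determinantal representation ⇒ Mahajan–Vinay layered affine DAG (tree: `exists_dag_of_isAffineDetRepr`) ⇒
`homogeneous_cut` (split `Λ = Λ₀ + Λ₁` into constant and linear part, `(1-Λ)⁻¹ = (Σ_d (N₀Λ₁)^d) N₀` with `N₀ = (1-Λ₀)⁻¹`,
take the degree-`n` component, cut `(N₀Λ₁)^n = (N₀Λ₁)^k (N₀Λ₁)^{n-k}`).  `zeroOneGrenet` — Grenet's cover is 0/1.  With these,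
the line's composition gives `CentralLaplaceRigidity → CoverDecancellation` outright
(`coverDecancellation_of_centralLaplaceRigidity` in `Lines/laplace_rigidity.lean`).  Honest framing: structure lemmas for a
line of the crux `CoverDecancellation` (stmt-ValiantsHypothesis-17819, route PolyaContinued); the line's law
`CentralLaplaceRigidity`, the crux and VP ≠ VNP are OPEN and NOT moved by this file.
-/

-- single-conjunct layout: Sub = Summit, duplicated namespace component intended
set_option linter.dupNamespace false

open MvPolynomial Matrix

namespace Summit.ValiantsHypothesis.ValiantsHypothesis.Theorems.PolyaContinuedLaplaceRigidity.Supports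



variable {σ : Type*} {ι : Type*} [Fintype ι] [DecidableEq ι]

omit [DecidableEq ι] in
/-- Entrywise homogeneity is multiplicative: degree-`a` times degree-`b` entries give degree-`a+b` entries. [folklore] -/
theorem homEntries_mul {M M' : Matrix ι ι (MvPolynomial σ ℂ)} {a b : ℕ} (h : (∀ i j, (M i j).IsHomogeneous a))
    (h' : (∀ i j, (M' i j).IsHomogeneous b)) : (∀ i j, ((M * M') i j).IsHomogeneous (a + b)) := by
  intro i j
  rw [Matrix.mul_apply]
  exact IsHomogeneous.sum _ _ _ fun l _ => (h i l).mul (h' l j)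

omit [Fintype ι] in
/-- The identity matrix has entries homogeneous of degree `0`. [folklore] -/
theorem homEntries_one : (∀ i j, ((1 : Matrix ι ι (MvPolynomial σ ℂ)) i j).IsHomogeneous 0) := by
  intro i j
  rw [Matrix.one_apply]
  split_ifs
  · exact isHomogeneous_one σ ℂ
  · exact isHomogeneous_zero σ ℂ 0

/-- Powers of a matrix with degree-`a` homogeneous entries have degree-`k·a` homogeneous entries. [folklore] -/
theorem homEntries_pow {M : Matrix ι ι (MvPolynomial σ ℂ)} {a : ℕ} (h : (∀ i j, (M i j).IsHomogeneous a)) :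
    ∀ d : ℕ, (∀ i j, ((M ^ d) i j).IsHomogeneous (d * a))
  | 0 => by rw [pow_zero, zero_mul]; exact homEntries_one
  | d + 1 => by rw [pow_succ, Nat.succ_mul]; exact homEntries_mul (homEntries_pow h d) h

omit [Fintype ι] [DecidableEq ι] in
/-- Sums of matrices with degree-`a` homogeneous entries have degree-`a` homogeneous entries. [folklore] -/
theorem homEntries_sum {s : Finset ℕ} {F : ℕ → Matrix ι ι (MvPolynomial σ ℂ)} {a : ℕ}
    (h : ∀ d ∈ s, (∀ i j, ((F d) i j).IsHomogeneous a)) : (∀ i j, ((∑ d ∈ s, F d) i j).IsHomogeneous a) := by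
  intro i j
  rw [Matrix.sum_apply]
  exact IsHomogeneous.sum _ _ _ fun d hd => h d hd i j

omit [DecidableEq ι] in
/-- `M *ᵥ v` of homogeneous data is homogeneous of the summed degree. [folklore] -/
theorem homEntries_mulVec {M : Matrix ι ι (MvPolynomial σ ℂ)} {a b : ℕ} {v : ι → MvPolynomial σ ℂ}
    (h : (∀ i j, (M i j).IsHomogeneous a)) (hv : (∀ i, (v i).IsHomogeneous b)) : (∀ i, ((M *ᵥ v) i).IsHomogeneous (a + b)) := by
  intro i
  change IsHomogeneous (∑ j, M i j * v j) _
  exact IsHomogeneous.sum _ _ _ fun j _ => (h i j).mul (hv j)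

omit [DecidableEq ι] in
/-- `v ᵥ* M` of homogeneous data is homogeneous of the summed degree. [folklore] -/
theorem homVec_vecMul {M : Matrix ι ι (MvPolynomial σ ℂ)} {a b : ℕ} {v : ι → MvPolynomial σ ℂ}
    (hv : (∀ i, (v i).IsHomogeneous b)) (h : (∀ i j, (M i j).IsHomogeneous a)) : (∀ i, ((v ᵥ* M) i).IsHomogeneous (b + a)) := by
  intro j
  change IsHomogeneous (∑ i, v i * M i j) _
  exact IsHomogeneous.sum _ _ _ fun i _ => (hv i).mul (h i j)

omit [DecidableEq ι] in
/-- The dot product of homogeneous vectors is homogeneous of the summed degree. [folklore] -/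
theorem homVec_dotProduct {v w : ι → MvPolynomial σ ℂ} {a b : ℕ} (hv : (∀ i, (v i).IsHomogeneous a))
    (hw : (∀ i, (w i).IsHomogeneous b)) : (v ⬝ᵥ w).IsHomogeneous (a + b) :=
  IsHomogeneous.sum _ _ _ fun i _ => (hv i).mul (hw i)

omit [DecidableEq ι] in
/-- Layering (non-zero entries raise the rank by at least the weight) is multiplicative. [folklore] -/
theorem layered_mul {r : ι → ℕ} {M M' : Matrix ι ι (MvPolynomial σ ℂ)} {a b : ℕ}
    (h : (∀ i j, M i j ≠ 0 → r i + a ≤ r j)) (h' : (∀ i j, M' i j ≠ 0 → r i + b ≤ r j)) : (∀ i j, (M * M') i j ≠ 0 → r i + (a + b) ≤ r j) := by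
  intro i j hij
  rw [Matrix.mul_apply] at hij
  obtain ⟨l, -, hl⟩ := Finset.exists_ne_zero_of_sum_ne_zero hij
  have h1 : M i l ≠ 0 := fun h0 => hl (by rw [h0, zero_mul])
  have h2 : M' l j ≠ 0 := fun h0 => hl (by rw [h0, mul_zero])
  have := h i l h1
  have := h' l j h2
  omega

omit [Fintype ι] in
/-- The identity matrix is layered of weight `0`. [folklore] -/
theorem layered_one {r : ι → ℕ} : (∀ i j, (1 : Matrix ι ι (MvPolynomial σ ℂ)) i j ≠ 0 → r i + 0 ≤ r j) := by
  intro i j hij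
  by_cases h : i = j
  · subst h; simp
  · exact absurd (Matrix.one_apply_ne h) hij

/-- Powers of a weight-`a` layered matrix are layered of weight `k·a`. [folklore] -/
theorem layered_pow {r : ι → ℕ} {M : Matrix ι ι (MvPolynomial σ ℂ)} {a : ℕ} (h : (∀ i j, M i j ≠ 0 → r i + a ≤ r j)) :
    ∀ d : ℕ, (∀ i j, (M ^ d) i j ≠ 0 → r i + (d * a) ≤ r j)
  | 0 => by rw [pow_zero, zero_mul]; exact layered_one
  | d + 1 => by rw [pow_succ, Nat.succ_mul]; exact layered_mul (layered_pow h d) h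

omit [Fintype ι] [DecidableEq ι] in
/-- Sums of weight-`a` layered matrices are layered of weight `a`. [folklore] -/
theorem layered_sum {r : ι → ℕ} {s : Finset ℕ} {F : ℕ → Matrix ι ι (MvPolynomial σ ℂ)} {a : ℕ}
    (h : ∀ d ∈ s, (∀ i j, (F d) i j ≠ 0 → r i + a ≤ r j)) : (∀ i j, (∑ d ∈ s, F d) i j ≠ 0 → r i + a ≤ r j) := by
  intro i j hij
  rw [Matrix.sum_apply] at hij
  obtain ⟨d, hd, hdij⟩ := Finset.exists_ne_zero_of_sum_ne_zero hij
  exact h d hd i j hdij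

omit [Fintype ι] [DecidableEq ι] in
/-- Layering is monotone in the weight. [folklore] -/
theorem layered_mono {r : ι → ℕ} {M : Matrix ι ι (MvPolynomial σ ℂ)} {a b : ℕ} (hab : b ≤ a)
    (h : (∀ i j, M i j ≠ 0 → r i + a ≤ r j)) : (∀ i j, M i j ≠ 0 → r i + b ≤ r j) := fun i j hij => by have := h i j hij; omega

/-- A strictly layered matrix on a finite rank set is nilpotent: a high enough power vanishes. [folklore] -/
theorem layered_pow_eq_zero {r : ι → ℕ} {M : Matrix ι ι (MvPolynomial σ ℂ)} (h : (∀ i j, M i j ≠ 0 → r i + 1 ≤ r j))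
    {L : ℕ} (hL : ∀ v, r v < L) : M ^ L = 0 := by
  refine Matrix.ext fun i j => ?_
  rw [Matrix.zero_apply]
  by_contra hne
  have := (layered_pow h L) i j hne
  have := hL j
  omega

/-- An affine polynomial splits as constant part + linear part. -/
theorem affine_split (φ : MvPolynomial σ ℂ) (h : φ.totalDegree ≤ 1) :
    φ = C (coeff 0 φ) + homogeneousComponent 1 φ := by
  have hs := sum_homogeneousComponent φ
  rw [← homogeneousComponent_zero]
  rcases Nat.lt_or_ge φ.totalDegree 1 with h0 | h1
  · have h00 : φ.totalDegree = 0 := by omega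
    rw [h00] at hs
    rw [homogeneousComponent_eq_zero 1 φ h0, add_zero]
    simpa using hs.symm
  · have h11 : φ.totalDegree = 1 := le_antisymm h h1
    rw [h11] at hs
    simpa [Finset.sum_range_succ] using hs.symm

omit [DecidableEq ι] in
/-- `(Σ_s F s) *ᵥ v = Σ_s (F s *ᵥ v)`. [folklore] -/
theorem sum_mulVec (s : Finset ℕ) (F : ℕ → Matrix ι ι (MvPolynomial σ ℂ)) (v : ι → MvPolynomial σ ℂ) :
    (∑ d ∈ s, F d) *ᵥ v = ∑ d ∈ s, F d *ᵥ v := by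
  classical
  induction s using Finset.induction_on with
  | empty => simp
  | insert a s ha ih => rw [Finset.sum_insert ha, Finset.sum_insert ha, Matrix.add_mulVec, ih]

omit [DecidableEq ι] in
/-- `u ⬝ (Σ_s w s) = Σ_s (u ⬝ w s)`. [folklore] -/
theorem dotProduct_sum' (u : ι → MvPolynomial σ ℂ) (s : Finset ℕ) (w : ℕ → ι → MvPolynomial σ ℂ) :
    u ⬝ᵥ (∑ d ∈ s, w d) = ∑ d ∈ s, u ⬝ᵥ w d := by
  classical
  induction s using Finset.induction_on with
  | empty => simp
  | insert a s ha ih => rw [Finset.sum_insert ha, Finset.sum_insert ha, dotProduct_add, ih]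

/-- **Homogeneous cut of a layered affine DAG.**  If `f = src ⬝ G snk` with `(1 - Λ) G = 1`,
`Λ` strictly layered with affine entries, `src` affine, `snk` constant, and `f` is homogeneous of
degree `n`, then for every `1 ≤ k ≤ n`, `f = Σ_{v ∈ ι ⊕ ι} p_v q_v` with every `p_v` homogeneous
of degree `k` and every `q_v` homogeneous of degree `n - k` (cut the degree-graded path sums at
degree `k`).  [cite: Nisan1991, §4 (homogeneous ABP layers); MahajanVinay1997, §3] -/
theorem homogeneous_cut (r : ι → ℕ) (Λ G : Matrix ι ι (MvPolynomial σ ℂ))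
    (src snk : ι → MvPolynomial σ ℂ) (f : MvPolynomial σ ℂ) (n k : ℕ)
    (hΛr : ∀ i j, Λ i j ≠ 0 → r i < r j) (hΛd : ∀ i j, (Λ i j).totalDegree ≤ 1)
    (hsrc : ∀ i, (src i).totalDegree ≤ 1) (hsnk : ∀ i, ∃ c, snk i = C c)
    (hG : (1 - Λ) * G = 1) (hf : src ⬝ᵥ (G *ᵥ snk) = f) (hfn : f.IsHomogeneous n)
    (hk1 : 1 ≤ k) (hkn : k ≤ n) :
    ∃ p q : ι ⊕ ι → MvPolynomial σ ℂ, (∀ v, (p v).IsHomogeneous k) ∧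
      (∀ v, (q v).IsHomogeneous (n - k)) ∧ f = ∑ v, p v * q v := by
  classical
  -- constant / linear parts
  set Λ₀ : Matrix ι ι (MvPolynomial σ ℂ) := Matrix.of fun i j => C (coeff 0 (Λ i j)) with hΛ₀
  set Λ₁ : Matrix ι ι (MvPolynomial σ ℂ) := Matrix.of fun i j => homogeneousComponent 1 (Λ i j)
    with hΛ₁
  set s₀ : ι → MvPolynomial σ ℂ := fun i => C (coeff 0 (src i)) with hs₀
  set s₁ : ι → MvPolynomial σ ℂ := fun i => homogeneousComponent 1 (src i) with hs₁
  have hΛsplit : Λ = Λ₀ + Λ₁ := by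
    refine Matrix.ext fun i j => ?_
    rw [Matrix.add_apply, hΛ₀, hΛ₁, Matrix.of_apply, Matrix.of_apply]
    exact affine_split _ (hΛd i j)
  have hsrcsplit : src = s₀ + s₁ := by
    funext i
    rw [Pi.add_apply]
    exact affine_split _ (hsrc i)
  have hΛ₀h : (∀ i j, (Λ₀ i j).IsHomogeneous 0) := fun i j => by rw [hΛ₀, Matrix.of_apply]; exact isHomogeneous_C _ _
  have hΛ₁h : (∀ i j, (Λ₁ i j).IsHomogeneous 1) := fun i j => by
    rw [hΛ₁, Matrix.of_apply]; exact homogeneousComponent_isHomogeneous 1 _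
  have hs₀h : (∀ i, (s₀ i).IsHomogeneous 0) := fun i => isHomogeneous_C _ _
  have hs₁h : (∀ i, (s₁ i).IsHomogeneous 1) := fun i => homogeneousComponent_isHomogeneous 1 _
  have hsnkh : (∀ i, (snk i).IsHomogeneous 0) := fun i => by
    obtain ⟨c, hc⟩ := hsnk i; rw [hc]; exact isHomogeneous_C _ _
  have hΛ₀l : (∀ i j, Λ₀ i j ≠ 0 → r i + 1 ≤ r j) := by
    intro i j hij
    rw [hΛ₀, Matrix.of_apply] at hij
    have : Λ i j ≠ 0 := by
      intro h0; apply hij; rw [h0, coeff_zero, C_0]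
    exact hΛr i j this
  have hΛ₁l : (∀ i j, Λ₁ i j ≠ 0 → r i + 1 ≤ r j) := by
    intro i j hij
    rw [hΛ₁, Matrix.of_apply] at hij
    have : Λ i j ≠ 0 := by
      intro h0; apply hij; rw [h0, map_zero]
    exact hΛr i j this
  -- nilpotency index (also larger than `n + 1`, for the bookkeeping below)
  set L : ℕ := Finset.univ.sup r + n + 2 with hLdef
  have hL : ∀ v, r v < L := fun v => by
    have := Finset.le_sup (f := r) (Finset.mem_univ v); omega
  -- N₀ = (1 - Λ₀)⁻¹
  set N₀ : Matrix ι ι (MvPolynomial σ ℂ) := ∑ d ∈ Finset.range L, Λ₀ ^ d with hN₀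
  have h10 : (1 - Λ₀) * N₀ = 1 := by
    rw [hN₀, mul_neg_geom_sum, layered_pow_eq_zero hΛ₀l hL, sub_zero]
  have hN₀h : (∀ i j, (N₀ i j).IsHomogeneous 0) :=
    homEntries_sum fun d _ => by simpa using homEntries_pow hΛ₀h d
  have hN₀l : (∀ i j, N₀ i j ≠ 0 → r i + 0 ≤ r j) :=
    layered_sum fun d _ => layered_mono (Nat.zero_le _) (layered_pow hΛ₀l d)
  -- M = N₀ Λ₁ : strictly layered, linear entries
  set M : Matrix ι ι (MvPolynomial σ ℂ) := N₀ * Λ₁ with hM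
  have hMh : (∀ i j, (M i j).IsHomogeneous 1) := by simpa using homEntries_mul hN₀h hΛ₁h
  have hMl : (∀ i j, M i j ≠ 0 → r i + 1 ≤ r j) := by simpa using layered_mul hN₀l hΛ₁l
  have hM0 : M ^ L = 0 := layered_pow_eq_zero hMl hL
  -- the explicit inverse
  set G' : Matrix ι ι (MvPolynomial σ ℂ) := (∑ d ∈ Finset.range L, M ^ d) * N₀ with hG'
  have e1 : (1 - Λ₀) * (1 - M) = 1 - Λ := by
    rw [mul_sub, mul_one, hM, ← Matrix.mul_assoc, h10, Matrix.one_mul, hΛsplit, sub_sub]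
  have hG'1 : (1 - Λ) * G' = 1 := by
    rw [← e1, hG', Matrix.mul_assoc, ← Matrix.mul_assoc (1 - M), mul_neg_geom_sum, hM0, sub_zero,
      Matrix.one_mul, h10]
  have hGG' : G = G' := by
    have h1 : G * (1 - Λ) = 1 := mul_eq_one_comm.mp hG
    calc G = G * ((1 - Λ) * G') := by rw [hG'1, Matrix.mul_one]
      _ = G' := by rw [← Matrix.mul_assoc, h1, Matrix.one_mul]
  -- graded pieces
  set Q : ℕ → ι → MvPolynomial σ ℂ := fun d => (M ^ d * N₀) *ᵥ snk with hQ
  have hQh : ∀ d, (∀ i, ((Q d) i).IsHomogeneous d) := fun d => by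
    have : (∀ i j, ((M ^ d * N₀) i j).IsHomogeneous d) := by simpa using homEntries_mul (homEntries_pow hMh d) hN₀h
    simpa using homEntries_mulVec this hsnkh
  have hT : ∀ d, (s₀ ⬝ᵥ Q d).IsHomogeneous d := fun d => by simpa using homVec_dotProduct hs₀h (hQh d)
  have hU : ∀ d, (s₁ ⬝ᵥ Q d).IsHomogeneous (d + 1) := fun d => by
    simpa [add_comm] using homVec_dotProduct hs₁h (hQh d)
  have hfsum : f = ∑ d ∈ Finset.range L, (s₀ ⬝ᵥ Q d + s₁ ⬝ᵥ Q d) := by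
    rw [← hf, hGG', hG', Finset.sum_mul, sum_mulVec, dotProduct_sum', hsrcsplit]
    refine Finset.sum_congr rfl fun d _ => ?_
    rw [add_dotProduct]
  -- extract the degree-n component
  have hn1 : 1 ≤ n := hk1.trans hkn
  have hfcomp : f = s₀ ⬝ᵥ Q n + s₁ ⬝ᵥ Q (n - 1) := by
    have hc : homogeneousComponent n f = f := by
      rw [homogeneousComponent_of_mem (mem_homogeneousSubmodule n f |>.mpr hfn), if_pos rfl]
    rw [← hc, hfsum, map_sum]
    simp_rw [map_add]
    rw [Finset.sum_add_distrib]
    have hA : ∀ d, homogeneousComponent n (s₀ ⬝ᵥ Q d) = if n = d then s₀ ⬝ᵥ Q d else 0 := fun d =>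
      homogeneousComponent_of_mem ((mem_homogeneousSubmodule d _).mpr (hT d))
    have hB : ∀ d, homogeneousComponent n (s₁ ⬝ᵥ Q d) = if n - 1 = d then s₁ ⬝ᵥ Q d else 0 := by
      intro d
      rw [homogeneousComponent_of_mem ((mem_homogeneousSubmodule (d + 1) _).mpr (hU d))]
      have : (n = d + 1) ↔ (n - 1 = d) := by omega
      simp only [this]
    simp_rw [hA, hB]
    rw [Finset.sum_ite_eq, Finset.sum_ite_eq, if_pos (Finset.mem_range.mpr (by omega)),
      if_pos (Finset.mem_range.mpr (by omega))]
  -- the cut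
  have hcutT : s₀ ⬝ᵥ Q n = (s₀ ᵥ* M ^ k) ⬝ᵥ Q (n - k) := by
    rw [hQ]
    dsimp only
    rw [show n = k + (n - k) from (Nat.add_sub_cancel' hkn).symm, pow_add, Nat.add_sub_cancel_left,
      Matrix.mul_assoc, ← Matrix.mulVec_mulVec, dotProduct_mulVec]
  have hcutU : s₁ ⬝ᵥ Q (n - 1) = (s₁ ᵥ* M ^ (k - 1)) ⬝ᵥ Q (n - k) := by
    rw [hQ]
    dsimp only
    rw [show n - 1 = (k - 1) + (n - k) by omega, pow_add, Matrix.mul_assoc, ← Matrix.mulVec_mulVec,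
      dotProduct_mulVec]
  refine ⟨Sum.elim (s₀ ᵥ* M ^ k) (s₁ ᵥ* M ^ (k - 1)), Sum.elim (Q (n - k)) (Q (n - k)), ?_, ?_, ?_⟩
  · rintro (v | v)
    · simpa using (homVec_vecMul hs₀h (homEntries_pow hMh k)) v
    · have := (homVec_vecMul hs₁h (homEntries_pow hMh (k - 1))) v
      simpa [show 1 + (k - 1) = k by omega] using this
  · rintro (v | v) <;> simpa using hQh (n - k) v
  · rw [hfcomp, hcutT, hcutU, Fintype.sum_sum_type]
    simp only [Sum.elim_inl, Sum.elim_inr]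
    rfl



end Summit.ValiantsHypothesis.ValiantsHypothesis.Theorems.PolyaContinuedLaplaceRigidity.Supports
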